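import Literature.Geometry.Lorentzian.CoordAdjointCutoff
import Literature.Geometry.Lorentzian.CoordConjugateHeat
import HarnessLib

/-!
# Leibniz rules for the lapse rows of the adjoint constraint operator on a cut-off lapse

Topic `Literature/Geometry/Lorentzian`, coordinate tensor calculus `MetricCoord`. Everything here is
PROVED; no definition and no statement of `Prop` type is introduced.

`CoordAdjointCutoff.lean` records the Leibniz rules of the `Y`-rows `adjMomKS`, `adjMomGS` of the
formal adjoint `P*` on a cut-off vector field `ψX`. This file adds the `N`-rows on a cut-off lapse
`χN` — the commutator `[P*, χ]` is of first order in `(N, dN)` with coefficients `dχ, Hess χ, Δχ`,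
which is what makes cut-off arguments (localisation of the coercivity estimates (3.1)/(3.4) of
Chruściel–Delay 2003, §3; cokernel projections of Corvino–Schoen type) work:

* `adjHamK_mul` — `DH*_κ(χN) = χ DH*_κ(N)` (the `κ`-row is of order zero in `N`);
* `IsMetricOn.adjScalAt_mul` — `DS*(χN) = χ DS*(N) − (NΔχ + 2⟨dχ,dN⟩) G + N Hess χ + dχ⊗dN + dN⊗dχ`;
* `IsMetricOn.adjHamG_mul` — `DH*_γ(χN) = χ DH*_γ(N) − (NΔχ + 2⟨dχ,dN⟩) G + N Hess χ + dχ⊗dN + dN⊗dχ`.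

## References

* P. T. Chruściel, E. Delay, Mém. Soc. Math. Fr. 94 (2003), §2–§3. [ChruscielDelay2003]
* J. Corvino, R. Schoen, J. Differential Geom. 73 (2006), §2–§3. [CorvinoSchoen2006]
-/

noncomputable section

set_option maxSynthPendingDepth 3

open Set Filter Module Function
open scoped Topology ContDiff

namespace Literature.Geometry.Lorentzian

namespace MetricCoord

variable {E : Type*} [NormedAddCommGroup E] [NormedSpace ℝ E] [FiniteDimensional ℝ E]
  [CompleteSpace E] {G K : E → E →L[ℝ] E →L[ℝ] ℝ} {V : Set E} {x : E} {χ N : E → ℝ}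

omit [FiniteDimensional ℝ E] [CompleteSpace E] in
/-- **`DH*_κ(χN) = χ DH*_κ(N)`**: the `κ`-row `−2N K + 2N (tr K) G` is of order zero in `N`.
[cite: ChruscielDelay2003, §2] -/
theorem adjHamK_mul (χ N : E → ℝ) :
    adjHamK G K (fun y ↦ χ y * N y) x = χ x • adjHamK G K N x := by
  ext v w
  simp only [adjHamK, _root_.add_apply, _root_.smul_apply, smul_eq_mul]
  ring

omit [CompleteSpace E] in
/-- **Leibniz rule for `DS*`**: for `χ, N` of class `C²` at a point `x ∈ V`,
`DS*(χN) = χ DS*(N) − (NΔχ + 2 dχ(♯dN)) G + N Hess χ + dχ ⊗ dN + dN ⊗ dχ`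
(`DS*(f) = −(Δf)G + Hess f − f Ric`; product rules for `Hess` and `Δ`).
[cite: ChruscielDelay2003, §2] -/
theorem IsMetricOn.adjScalAt_mul (hG : IsMetricOn G V) (hx : x ∈ V)
    (hχ : ContDiffAt ℝ 2 χ x) (hN : ContDiffAt ℝ 2 N x) :
    adjScalAt G (fun y ↦ χ y * N y) x =
      χ x • adjScalAt G N x
        - (N x * lapAt G χ x + 2 * fderiv ℝ χ x (sharpAt G x (fderiv ℝ N x))) • G x
        + N x • hessAt G χ x
        + (fderiv ℝ χ x).smulRight (fderiv ℝ N x) + (fderiv ℝ N x).smulRight (fderiv ℝ χ x) := by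
  have hi := hG.isInvertible x hx
  have hs := hG.symm x hx
  rw [adjScalAt, adjScalAt, lapAt_mul G hi hs hχ hN, hessAt_mul G hχ hN]
  ext v w
  simp only [_root_.add_apply, _root_.sub_apply, _root_.smul_apply, smul_eq_mul,
    ContinuousLinearMap.smulRight_apply]
  ring

omit [CompleteSpace E] in
/-- **Leibniz rule for the `γ`-row `DH*_γ`**: for `χ, N` of class `C²` at `x ∈ V`,
`DH*_γ(χN) = χ DH*_γ(N) − (NΔχ + 2 dχ(♯dN)) G + N Hess χ + dχ ⊗ dN + dN ⊗ dχ`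
(`DH*_γ(N) = DS*(N) + 2N K∘K − 2N (tr K) K`: the `K`-terms are of order zero in `N`).
[cite: ChruscielDelay2003, §2] -/
theorem IsMetricOn.adjHamG_mul (hG : IsMetricOn G V) (hx : x ∈ V)
    (hχ : ContDiffAt ℝ 2 χ x) (hN : ContDiffAt ℝ 2 N x) :
    adjHamG G K (fun y ↦ χ y * N y) x =
      χ x • adjHamG G K N x
        - (N x * lapAt G χ x + 2 * fderiv ℝ χ x (sharpAt G x (fderiv ℝ N x))) • G x
        + N x • hessAt G χ x
        + (fderiv ℝ χ x).smulRight (fderiv ℝ N x) + (fderiv ℝ N x).smulRight (fderiv ℝ χ x) := by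
  rw [adjHamG, adjHamG, hG.adjScalAt_mul hx hχ hN]
  ext v w
  simp only [_root_.add_apply, _root_.sub_apply, _root_.smul_apply, smul_eq_mul,
    ContinuousLinearMap.smulRight_apply]
  ring

end MetricCoord

end Literature.Geometry.Lorentzian

end
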